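import Summits.QuantumFields.BalabanUV.T4Continuum.Spine.NE9.DirectPairingMarginChannel
import Summits.QuantumFields.BalabanUV.T4Continuum.Spine.NE9.DirectPairingUniformCarriers

/-!
# T⁴ programme, spine estimate NE9 — NODE U5b (the uniform-in-the-scale bracket) ON THE TOWER OF CARRIERS FROM THE STEP CLAUSES, FROM
# MARGINS, AND FROM THE LINEAR CHANNEL — the second consumer of NE9 served from the same E-side list as node U6 (census C33 ∕ C37 ∕ C37b
# junctions BY NAME) — census item C37d of cell `pub-balaban-gaps`, seat ne9 (gen 9)

Cell `pub-balaban-gaps` (YM blitz G2, seat ne9, unit `pub-balaban-gaps-ne9-g9`; record `run/shared/lean/pub/pub-balaban-gaps/ne/NE9.md` §5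
row C37d).  Summits-side bookkeeping; composition of landed theorems BY NAME; NO definition; nothing of Bałaban's asserted.

CONTEXT.  NE9 has TWO consumers on the T⁴ spine: node U3 → U6 (the Cauchy∕King bracket between runs) and node U5b (the bracket UNIFORM in the
scale, `T4OutputRate.historySum_le_of_fadingMemory`'s role).  Gen 8 served U5b on the carriers from `TowerCarriersKing`'s carriers-level `hUC`
(`DirectPairingUniformCarriers.uniformSmall_carriers`, p357924) and gen 7 produced that `hUC` from the run-uniform STEP clauses [UC-OLD]∕[UC-LAST] +
read-outs (`DirectPairingPropagationCarriers.sepUC_carriers_of_propagation`, p353180) — but the U5b composite was assembled only for node U6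
(`king_U6_of_propagation`).  Gen 9 discharged the step clauses from MARGINS (`DirectPairingMargin`, p358731) and read the margin off [II]'s LINEAR
CHANNEL (`DirectPairingMarginChannel`).  This file closes the U5b side of all three junctions BY NAME, so that BOTH consumers of NE9 are fed
from the final E-side list {tower-NE5 · Markov∕linear-channel∕read-out structure · channel constants with slack · (AN-LAST)+margin}.

WHAT IS PROVED (0 sorry; three compositions).
* `uniformSmall_carriers_of_propagation`: tower-NE5 + one Markov recursion per run with [UC-OLD] + [UC-LAST] (run-uniform) + uniformly continuous
  read-outs ⇒ ∀ η > 0 ∃ δ > 0: for EVERY run `k`, background, domain (`r X ≤ k`) and admissible histories `δ`-close below the scale,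
  `|E k g U X − E k g' U X| ≤ η·e^{−κd(X)}` (`uniformSmall_carriers` ∘ `prefix_carriers_of_markov` ∘ `sepUC_carriers_of_propagation`).
* `uniformSmall_carriers_of_margin`: the same with [UC-OLD]∕[UC-LAST] DISCHARGED by (AN-OLD)+margin ∕ (AN-LAST)+margin
  (`DirectPairingMargin.uniformOld_of_margin` ∕ `uniformLast_of_margin`).
* `uniformSmall_carriers_of_linearChannel`: the same with (AN-OLD)+margin READ OFF the linear channel (`DirectPairingMarginChannel.
  oldMargin_of_linearChannel`, slack `C_T·(E₀ + ϱ) < R`) and the read-out clause from coordinate functionals (`readOut_uniform_of_coordinate`).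
No fading memory, no history moduli `Λ`, no row sums, no stabilisation, no compactness among the hypotheses of any of the three.

HONEST FRAMING: bookkeeping for rung (B)+1 on ONE FIXED finite four-torus; compositions of kernel theorems on hypothesis SHAPES; tower-NE5 = the
cell's estimate NE5 (NOT PRINTED, NOT PROVED); the step clauses ∕ margins ∕ linear-channel form for Bałaban's step are H∃ readings of the ONE-STEP
object (W1, instance 0∕1), NOT PRINTED as theorems ∕ NOT PROVED; NE9 NOT PRINTED ∕ NOT PROVED; spine 0∕9; NOT continuum ∕ ℝ⁴ ∕ mass gap ∕ Clay.
CLASSIFICATION OF NE9 UNCHANGED: WORK-bound (W1).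

References (TYPES only): [Balaban1987RG1] = T. Bałaban, Commun. Math. Phys. **109** (1987) 249–301, p. 256, Thm 1 p. 259, (1.18) p. 263;
[Balaban1988RG2Cluster] = T. Bałaban, Commun. Math. Phys. **116** (1988) 1–22, Lemma 1 (1.33)–(1.36) p. 9, (2.13)–(2.14) pp. 14–15, p. 21;
[King1986] = C. King, Commun. Math. Phys. **102** (1986) 649–677, §3.2.
-/

namespace Summit.QuantumFields.BalabanUV.T4Continuum.NE9.DirectPairingMarginU5b

open scoped BigOperators
open Filter Topology Metric Set
open Literature.MathematicalPhysics.QuantumFieldTheory.Balaban1983to89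
open Literature.MathematicalPhysics.QuantumFieldTheory.Balaban1983to89.T4CouplingAnalyticity (BoxWindow)
open Summit.QuantumFields.BalabanUV.T4Continuum.NE9.TowerCarriers
open Summit.QuantumFields.BalabanUV.T4Continuum.NE9.TowerCarriersBox (TowerNE5On)
open Summit.QuantumFields.BalabanUV.T4Continuum.NE9.DirectPairingPropagationCarriers
  (prefix_carriers_of_markov sepUC_carriers_of_propagation)
open Summit.QuantumFields.BalabanUV.T4Continuum.NE9.DirectPairingUniformCarriers (uniformSmall_carriers)
open Summit.QuantumFields.BalabanUV.T4Continuum.NE9.DirectPairingMargin (uniformOld_of_margin uniformLast_of_margin)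
open Summit.QuantumFields.BalabanUV.T4Continuum.NE9.DirectPairingMarginChannel
  (oldMargin_of_linearChannel readOut_uniform_of_coordinate)

/-! ## §1 Node U5b from the run-uniform step clauses (the C33 junction for the second consumer) -/

section StepClauses

variable (T : TowerData) {E : ℕ → (ℕ → ℝ) → T.B → T.Dom → ℝ} {I : Set ℝ} {κ : ℝ}
  {S : Type*} [PseudoMetricSpace S] {V : ℕ → ℕ → (ℕ → ℝ) → S} {Φ : ℕ → ℕ → ℝ → S → S} {A : ℕ → Set S}
  {ev : ℕ → T.B → T.Dom → S → ℝ}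

/-- **NODE U5b ON THE CARRIERS FROM THE STEP CLAUSES** (`DirectPairingUniformCarriers.uniformSmall_carriers` BY NAME, its `hP` and `hUC` supplied by
`DirectPairingPropagationCarriers.prefix_carriers_of_markov` ∕ `sepUC_carriers_of_propagation`): tower-NE5 + one Markov recursion per run with a
coupling-free start, class membership, [UC-OLD] and [UC-LAST] with run-uniform moduli, and uniformly continuous read-outs ⇒ for every `η > 0` ONE
`δ > 0` such that for every run, background, domain and admissible histories `δ`-close below the scale the terms are `η·e^{−κd(X)}`-close.  No fading
memory, no moduli `Λ`. [folklore] -/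
theorem uniformSmall_carriers_of_propagation {θ C₅ : ℝ} (hC : 0 ≤ C₅) (hθ0 : 0 ≤ θ) (hθ1 : θ < 1)
    (h5 : TowerNE5On T E I κ θ C₅)
    (h0 : ∀ k, ∀ g ∈ BoxWindow I, ∀ g' ∈ BoxWindow I, V k 0 g = V k 0 g')
    (hrec : ∀ k j, ∀ g ∈ BoxWindow I, V k (j + 1) g = Φ k j (g j) (V k j g))
    (hmem : ∀ k m, ∀ g ∈ BoxWindow I, V k m g ∈ A m)
    (hold : ∀ j, ∀ ε : ℝ, 0 < ε → ∃ δ : ℝ, 0 < δ ∧ ∀ k, ∀ c ∈ I, ∀ w ∈ A j, ∀ w' ∈ A j,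
      dist w w' ≤ δ → dist (Φ k j c w) (Φ k j c w') ≤ ε)
    (hlast : ∀ j, ∀ ε : ℝ, 0 < ε → ∃ δ : ℝ, 0 < δ ∧ ∀ k, ∀ w ∈ A j, ∀ c ∈ I, ∀ c' ∈ I,
      |c - c'| ≤ δ → dist (Φ k j c w) (Φ k j c' w) ≤ ε)
    (hev : ∀ m, ∀ ε : ℝ, 0 < ε → ∃ δ : ℝ, 0 < δ ∧ ∀ (k : ℕ) (U : T.B) (X : T.Dom), T.r X + m = k →
      ∀ w ∈ A m, ∀ w' ∈ A m, dist w w' ≤ δ → Real.exp (κ * T.d X) * |ev k U X w - ev k U X w'| ≤ ε)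
    (hE : ∀ (k : ℕ) (U : T.B) (X : T.Dom), ∀ g ∈ BoxWindow I, E k g U X = ev k U X (V k (k - T.r X) g))
    {η : ℝ} (hη : 0 < η) :
    ∃ δ : ℝ, 0 < δ ∧ ∀ (k : ℕ) (U : T.B) (X : T.Dom), T.r X ≤ k →
      ∀ g ∈ BoxWindow I, ∀ g' ∈ BoxWindow I, (∀ i, i < k - T.r X → |g i - g' i| ≤ δ) →
        |E k g U X - E k g' U X| ≤ η * Real.exp (-(κ * T.d X)) :=
  uniformSmall_carriers T hC hθ0 hθ1 h5 (prefix_carriers_of_markov T h0 hrec hE)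
    (sepUC_carriers_of_propagation T h0 hrec hmem hold hlast hev hE) hη

end StepClauses

/-! ## §2 Node U5b from margins (the C37 junction for the second consumer) -/

section Margins

variable {F : Type*} [NormedAddCommGroup F] [NormedSpace ℂ F] [CompleteSpace F]
variable (T : TowerData) {E : ℕ → (ℕ → ℝ) → T.B → T.Dom → ℝ} {I : Set ℝ} {κ : ℝ}
  {V : ℕ → ℕ → (ℕ → ℝ) → F} {Φ : ℕ → ℕ → ℝ → F → F} {A : ℕ → Set F} {ev : ℕ → T.B → T.Dom → F → ℝ}

/-- **NODE U5b ON THE CARRIERS FROM MARGINS**: as `uniformSmall_carriers_of_propagation`, with [UC-OLD] ∕ [UC-LAST] DISCHARGED by (AN-OLD)+margin ∕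
(AN-LAST)+margin — per level ONE margin `ϱ` and ONE bound `M` for all runs (`DirectPairingMargin.uniformOld_of_margin` ∕ `uniformLast_of_margin`).
[folklore] -/
theorem uniformSmall_carriers_of_margin {θ C₅ : ℝ} (hC : 0 ≤ C₅) (hθ0 : 0 ≤ θ) (hθ1 : θ < 1)
    (h5 : TowerNE5On T E I κ θ C₅)
    (h0 : ∀ k, ∀ g ∈ BoxWindow I, ∀ g' ∈ BoxWindow I, V k 0 g = V k 0 g')
    (hrec : ∀ k j, ∀ g ∈ BoxWindow I, V k (j + 1) g = Φ k j (g j) (V k j g))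
    (hmem : ∀ k m, ∀ g ∈ BoxWindow I, V k m g ∈ A m)
    (hO : ∀ j, ∃ ϱ M : ℝ, 0 < ϱ ∧ ∀ k, ∀ c ∈ I, ∃ D : Set F,
      DifferentiableOn ℂ (Φ k j c) D ∧ (∀ z ∈ D, ‖Φ k j c z‖ ≤ M) ∧ ∀ w ∈ A j, closedBall w ϱ ⊆ D)
    (hLa : ∀ j, ∃ ϱ M : ℝ, 0 < ϱ ∧ ∀ k, ∀ w ∈ A j, ∃ (Ψ : ℂ → F) (D : Set ℂ),
      DifferentiableOn ℂ Ψ D ∧ (∀ z ∈ D, ‖Ψ z‖ ≤ M) ∧ (∀ c ∈ I, closedBall (c : ℂ) ϱ ⊆ D) ∧ ∀ c ∈ I, Ψ c = Φ k j c w)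
    (hev : ∀ m, ∀ ε : ℝ, 0 < ε → ∃ δ : ℝ, 0 < δ ∧ ∀ (k : ℕ) (U : T.B) (X : T.Dom), T.r X + m = k →
      ∀ w ∈ A m, ∀ w' ∈ A m, dist w w' ≤ δ → Real.exp (κ * T.d X) * |ev k U X w - ev k U X w'| ≤ ε)
    (hE : ∀ (k : ℕ) (U : T.B) (X : T.Dom), ∀ g ∈ BoxWindow I, E k g U X = ev k U X (V k (k - T.r X) g))
    {η : ℝ} (hη : 0 < η) :
    ∃ δ : ℝ, 0 < δ ∧ ∀ (k : ℕ) (U : T.B) (X : T.Dom), T.r X ≤ k →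
      ∀ g ∈ BoxWindow I, ∀ g' ∈ BoxWindow I, (∀ i, i < k - T.r X → |g i - g' i| ≤ δ) →
        |E k g U X - E k g' U X| ≤ η * Real.exp (-(κ * T.d X)) :=
  uniformSmall_carriers_of_propagation T hC hθ0 hθ1 h5 h0 hrec hmem (uniformOld_of_margin hO) (uniformLast_of_margin hLa)
    hev hE hη

end Margins

/-! ## §3 Node U5b from the linear channel (the C37b junction for the second consumer) -/

section Channel

variable {F : Type*} [NormedAddCommGroup F] [NormedSpace ℂ F] [CompleteSpace F]
variable {P : Type*} [NormedAddCommGroup P] [NormedSpace ℂ P]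
variable (T : TowerData) {I : Set ℝ} {κ : ℝ}
  {J : ℕ → ℕ → ℝ → (F →L[ℂ] F)} {Tp : ℕ → ℕ → ℝ → (F →L[ℂ] P)} {G : ℕ → ℕ → ℝ → P → F}
  {V : ℕ → ℕ → (ℕ → ℝ) → F} {ℓ : ℕ → T.B → T.Dom → (F →L[ℂ] ℂ)} {E : ℕ → (ℕ → ℝ) → T.B → T.Dom → ℝ}
  {E₀ : ℝ} {R M CJ CT ϱ : ℕ → ℝ}

/-- **NODE U5b ON THE CARRIERS FROM THE LINEAR CHANNEL**: tower-NE5 · one Markov recursion per run through the linear channel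
(`V k (j+1) g = J k j (g j) (V k j g) + G k j (g j) (Tp k j (g j) (V k j g))`) with a coupling-free start · class reproduction `‖V‖ ≤ E₀` · channel
constants per level uniform in run and coupling (`G` holomorphic and bounded by `M j` on the potential ball of radius `R j`, `‖J‖ ≤ C_J j`,
`‖Tp‖ ≤ C_T j`) with SLACK `C_T j·(E₀ + ϱ j) < R j` · (AN-LAST)+margin · coordinate read-outs `E k g U X = e^{−κd(X)}·Re ℓ(V k (k − r X) g)`, `‖ℓ‖ ≤ 1`
⇒ the U5b bracket: ∀ η > 0 ∃ δ > 0, δ-close histories below the scale give `η·e^{−κd(X)}`-close terms, uniformly in run ∕ scale ∕ background ∕ domain.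
[folklore] -/
theorem uniformSmall_carriers_of_linearChannel {θ C₅ : ℝ} (hC : 0 ≤ C₅) (hθ0 : 0 ≤ θ) (hθ1 : θ < 1)
    (h5 : TowerNE5On T E I κ θ C₅)
    (h0 : ∀ k, ∀ g ∈ BoxWindow I, ∀ g' ∈ BoxWindow I, V k 0 g = V k 0 g')
    (hrec : ∀ k j, ∀ g ∈ BoxWindow I, V k (j + 1) g = J k j (g j) (V k j g) + G k j (g j) (Tp k j (g j) (V k j g)))
    (hmem : ∀ k m, ∀ g ∈ BoxWindow I, V k m g ∈ closedBall (0 : F) E₀)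
    (hϱ : ∀ j, 0 < ϱ j)
    (hG : ∀ k j, ∀ c ∈ I, DifferentiableOn ℂ (G k j c) (ball 0 (R j)))
    (hM : ∀ k j, ∀ c ∈ I, ∀ q ∈ ball (0 : P) (R j), ‖G k j c q‖ ≤ M j)
    (hJ : ∀ k j, ∀ c ∈ I, ‖J k j c‖ ≤ CJ j) (hT : ∀ k j, ∀ c ∈ I, ‖Tp k j c‖ ≤ CT j)
    (hslack : ∀ j, CT j * (E₀ + ϱ j) < R j)
    (hLa : ∀ j, ∃ ϱ' M' : ℝ, 0 < ϱ' ∧ ∀ k, ∀ w ∈ closedBall (0 : F) E₀, ∃ (Ψ : ℂ → F) (D : Set ℂ),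
      DifferentiableOn ℂ Ψ D ∧ (∀ z ∈ D, ‖Ψ z‖ ≤ M') ∧ (∀ c ∈ I, closedBall (c : ℂ) ϱ' ⊆ D) ∧
        ∀ c ∈ I, Ψ c = J k j c w + G k j c (Tp k j c w))
    (hℓ : ∀ k U X, ‖ℓ k U X‖ ≤ 1)
    (hE : ∀ (k : ℕ) (U : T.B) (X : T.Dom), ∀ g ∈ BoxWindow I,
      E k g U X = Real.exp (-(κ * T.d X)) * (ℓ k U X (V k (k - T.r X) g)).re)
    {η : ℝ} (hη : 0 < η) :
    ∃ δ : ℝ, 0 < δ ∧ ∀ (k : ℕ) (U : T.B) (X : T.Dom), T.r X ≤ k →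
      ∀ g ∈ BoxWindow I, ∀ g' ∈ BoxWindow I, (∀ i, i < k - T.r X → |g i - g' i| ≤ δ) →
        |E k g U X - E k g' U X| ≤ η * Real.exp (-(κ * T.d X)) :=
  uniformSmall_carriers_of_margin T (V := V) (Φ := fun k j c w => J k j c w + G k j c (Tp k j c w))
    (A := fun _ => closedBall (0 : F) E₀) (ev := fun k U X w => Real.exp (-(κ * T.d X)) * (ℓ k U X w).re)
    hC hθ0 hθ1 h5 h0 hrec hmem (oldMargin_of_linearChannel (E₀ := fun _ => E₀) hϱ hG hM hJ hT hslack) hLa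
    (readOut_uniform_of_coordinate T hℓ _) hE hη

end Channel

end Summit.QuantumFields.BalabanUV.T4Continuum.NE9.DirectPairingMarginU5b
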